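import Literature.MathematicalPhysics.QuantumFieldTheory.Balaban1983to89.B8Prop7TowerAxialUnitary

/-!
# `Balaban1983to89.B8Prop7TowerAxialIneq145` — [Balaban1985RegularSpaces] **PROPOSITION 7, (1.145), FOR PRINT'S TOWER-WISE AXIAL GAUGE MAP** in the
# carrier's box form with the audit's repaired constant `530d`, at every law member of NODE 00's carrier `zdGF3` with `Ω₀ = ℤᵈ`, and the assembled
# **`B8Ineq145.Prop7RepairedC (530·d) (zdGF3 ∘ e) (toAxialTower ∘ e)`** — sequel (§5–§6) of `B8Prop7TowerAxialUnitary` (§1–§4: the clamped standing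
# data, `uTower` unitary and within `200d·α₂` of `1`, (1.144)), split at the 400-line bound; same programme, same honest scope

statement-level skeleton of published theorems with citation tags; proofs where landed; nothing here is a claim about the Yang–Mills mass gap

T. Bałaban, *Spaces of regular gauge field configurations on a lattice and gauge fixing conditions*, Commun. Math. Phys. **99** (1985) 75–102
`[Balaban1985RegularSpaces]` ("B8"; journal page = PDF page + 74): Prop. 7 (1.144)–(1.145) p. 100, (1.139)–(1.141) p. 100, (1.35) p. 82, (1.66) p. 88.
[3] = T. Bałaban, *Averaging operations for lattice gauge theories*, Commun. Math. Phys. **98** (1985) 17–51 `[Balaban1985Averaging]`: (69)–(71) p. 29,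
(161)–(163) p. 42, p. 24 («this definition is local»).  The audit of (1.145): `B8Ineq145` (G-adv8-16, constants-only: print's `2` fails on the bonds
crossing `∂Λ_j`; in the tree's box form below the top print claims nothing; r05 g7's all-levels constant `530d`).

## WHY THIS FILE (cell `pub-ymgap`, HUMAN RULING D-0062; R134 seat `pub-ymgap-dag-n05-c` g6, DAG node N05 = [B8]; count-neutral)

Brick 3 of the honest `p7` (P7 SPECIES NOTE 2026-08-27; brick 1 `B8Prop7TowerAxialZd3` p515888, brick 2 `B8Prop7TowerAxialUnitary`).  At a member `i` of
`zdGF3` with `Ω₀ = ℤᵈ` obeying NODE 00's located law №8, in the regime `0 < α₀, α₂ ≤ c(d, L)` (r05 g7's `cst`), for every datum with (1.139) `InA α₀ U₀`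
and (1.140) `C140 α₂ U₀ P`:
* §5 `bond_facts` + ★ `avgClose_toAxialTower`: (1.145) in the carrier's BOX FORM at EVERY level `j ≤ k` and EVERY `j`-bond whose box lies in `Ω_j`:
  `|(U′U₀)‾ʲ_b − Ū₀ʲ_b| ≤ 530d·α₂`, `U′U₀ = (U₁U₀)^{u}`, `u = uTower` — [3] (69)–(71): `Ũ′ʲ_b = u(b₋)·Ũʲ_b·R̄(u(b₊))⁻¹` (`tildIter_mgauge`) with
  `|u − 1| ≤ 200d·α₂` at both ends (`uTower_facts`; the two ends may lie in DIFFERENT towers, so the inter-tower bonds are covered) and `|Ũʲ_b − 1| ≤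
  130d·α₂` (r05 g7's `norm_tildIter_sub_one_le` for the pair clamped from the BOND BOX `Bʲ(b₋) ∪ Bʲ(b₊)`, transported by `avgIter_congr`);
  `Ū₀ʲ_b` unitary likewise; then `(U′U₀)‾ʲ_b − Ū₀ʲ_b = (Ũ′ʲ_b − 1)·Ū₀ʲ_b`.
* §6 ★★ `prop7RepairedC_zdGF3_toAxialTower`: `B8Ineq145.Prop7RepairedC (530·d) (zdGF3 ∘ e) (toAxialTower ∘ e)` for every `e : J → ZdIdx d L` into such
  members (threshold `cst d L`) — PROPOSITION 7 with the audit's repaired constant FOR PRINT'S MAP at the generality of the N05 knit's law-cut family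
  (`famB8OfRecordSubB θ β len = zdGF3 ∘ (·.1.1)`; laws `IdxB8Laws.trunc_lt ∕ trunc_top`; `Ω₀ = ℤᵈ` from `IdxB8`); the HONEST counterpart, at general
  members, of the junk certificate `B8Prop7GlevZd3.prop7PrintedR_zdGF3_unitAxial`; on the all-`ℤᵈ` family (`uTower_lamTop`) it is g4's
  `prop7RepairedC_zdGF3_univ` ∕ r05 g7's `prop7RepairedC_admitted`.
WHAT THIS DOES NOT DO: it does not prove the TYPED conjunct `Prop7PrintedR` (constant `2`), does not re-type the leaf, does not choose the species; the
knit's `p7` becomes dischargeable by §6 exactly if the chair words `p7′ := Prop7RepairedC C(d)` with `toAxial := toAxialTower` (species (S1)).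

## HONEST SCOPE

Kernel bookkeeping + by-name instantiation of landed theorems (`norm_tildIter_sub_one_le`, `avgIter(_mul)_mem_unitaryUnits`, `avgIter_congr`,
`tildIter_mgauge`, `clampedStanding`, `uTower_facts`); NO estimate of [Balaban1985RegularSpaces] or [3] is proved anew — the constants `200d`, `130d`,
`530d` and the threshold `c(d, L)` are r05 g7's, localised.  Count-neutral; N05 NOT discharged; `T_η ↦ ℤᵈ` carriers, `G = U(𝔸)`, `d ≥ 2`; one finite
`T⁴` programme at fixed `ε`, Bałaban as printed — nothing continuum ∕ ℝ⁴ ∕ OS ∕ mass-gap ∕ Clay.  No `sorry`, no `axiom`, no `instance`, no `notation`.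
Unit `pub-ymgap-dag-n05-c` (g6), 2026-08-27.

[cite: Balaban1985RegularSpaces, Prop. 7 (1.144)–(1.145) p.100, (1.139)–(1.141) p.100, (1.35) p.82, (1.66) p.88; Balaban1985Averaging, (69)–(71) p.29,
(161)–(163) p.42, p.24]
-/

noncomputable section

open NormedSpace

namespace Literature.MathematicalPhysics.QuantumFieldTheory.Balaban1983to89.B8Prop7TowerAxialIneq145

open B7Prop1Explicit B7Prop2Explicit B7Prop1Local B7Eq92Concrete B7Eq84Concrete
open B7Prop2Explicit (C0 c2' unitaryUnits_le_U1)
open B7Prop3Flat (c3)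
open B8Ineq130 (tlo thi)
open B8Ineq132 (InAk Under PlaqTouches BondTouches plaqF)
open B8Eq119TwistedAxial (InAx)
open B8Eq106Local (under_iff_tower)
open B8Eq140Level (SideTouches sideTouches_of_bondTouches)
open B8Eq146AExpansion (iEta expCfg norm_iEta_le)
open B8Eq155JBound (expCfg_iEta_mem_unitaryUnits)
open B8Lemma1NonAbelian (mulCfg)
open B8Thm4Concrete (mulCfg_eq_mul)
open B8Prop7AdmittedFamily (cst cst_pos glev_mem_unitaryUnits norm_glev_sub_one_le norm_tildIter_sub_one_le avgIter_mem_unitaryUnits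
  avgIter_mul_mem_unitaryUnits mgauge_mul_eq_gaugeAct_mulCfg)
open B7Prop8PrintedConstants (Rc_mem_unitaryUnits)
open B7AvgGaugeCovariance (uLev)
open B8Prop7GlevZd3 (c140_dictionary inAk_gaugeAct_of_c140)
open B8Ineq172Concrete (glev_congr_tower)
open B8Prop7TowerAxialUnitary (clampedStanding uTower_facts inAAx_toAxialTower_of_laws clampFld agreeOn_mul)
open B8Prop7TowerAxialZd3 (Covered towerDepth uTower toAxialTower inTower_towerDepth towerDepth_le uTower_of_covered uTower_of_not_covered
  inAAx_toAxialTower)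
open B8LeafModelZd (ZdIdx)
open B8LeafModelZd3 (zdGF3 mlogCfg)

-- `Site` alone could resolve to the torus sites of `Setup.lean`; re-export the `ℤ^d` sites of `B7Prop1Explicit`.
export B7Prop1Explicit (Site)

variable {d : ℕ}
/-! ## §5 (1.145) in the carrier's BOX FORM with the constant `530·d` for print's map: the `j`-averages at every bond of every level -/

section Arith

variable {𝔸 : Type} [CStarAlgebra 𝔸] [Nontrivial 𝔸] {L : ℕ}

/-- `|abc − 1| ≤ |a − 1| + |b − 1| + |c − 1|` for `a, b ∈ {|u| ≤ 1, |u⁻¹| ≤ 1}` (private arithmetic, as in r05 g7's file). [folklore] -/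
private theorem norm_mul₃_units_sub_one_le {a b c : 𝔸ˣ} (ha : a ∈ U1 𝔸) (hb' : b ∈ U1 𝔸) :
    ‖((a * b * c : 𝔸ˣ) : 𝔸) - 1‖ ≤ ‖(a : 𝔸) - 1‖ + ‖(b : 𝔸) - 1‖ + ‖(c : 𝔸) - 1‖ :=
  (B8Lemma1NonAbelian.norm_units_mul_sub_one_le ((U1 𝔸).mul_mem ha hb')).trans
    (by linarith [B8Lemma1NonAbelian.norm_units_mul_sub_one_le (q := b) ha])

/-- The bond box `Bʲ(c₋) ∪ Bʲ(c₊)` of `c = (z, μ)` is a genuine box (`L ≥ 1`; private plumbing). [folklore] -/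
private theorem loK_le_bondHiK (hL1 : 1 ≤ L) (j : ℕ) (z : Site d) (μ : Fin d) : ∀ i', loK L j z i' ≤ bondHiK L j z μ i' := by
  intro i'
  have h1 : (1 : ℤ) ≤ (L : ℤ) ^ j := by exact_mod_cast Nat.one_le_pow j L hL1
  simp only [loK, bondHiK]
  split_ifs <;> linarith

end Arith

section Ineq145

variable {𝔸 : Type} [CStarAlgebra 𝔸] [Nontrivial 𝔸] {L : ℕ} {β : ℝ} {len : Site d → ℝ}

/-- **THE AVERAGED PRODUCT AND BACKGROUND AT ONE BOND, localised** ([3] p. 24): for a `j`-bond `(z, μ)` whose box lies in `Ω_j` (`j ≤ k`), the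
averages `Ū₀ʲ_b`, `(U′U₀)‾ʲ_b` are those of the pair clamped from the bond box, hence — by r05 g7's standing theorems at depth `j` — `Ū₀ʲ_b` is
unitary-valued and `|Ũʲ_b − 1| ≤ 130d·α₂` ([3] (161)–(163) bookkeeping, `norm_tildIter_sub_one_le`).
[cite: Balaban1985RegularSpaces, (1.145) p.100, (1.143) p.100; Balaban1985Averaging, (69) p.29, (161)–(163) p.42, p.24] -/
theorem bond_facts (hd2 : 2 ≤ d) (hL : 2 ≤ L) (i : ZdIdx d L) (hΩ0 : i.Ω 0 = Set.univ)
    {α₀ α₂ : ℝ} (hα₀ : 0 < α₀) (hα₀c : α₀ ≤ cst d L) (hα₂ : 0 < α₂) (hα₂c : α₂ ≤ cst d L)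
    (U₀ : (zdGF3 𝔸 L β len i).Cfg) (P : (zdGF3 𝔸 L β len i).Pert)
    (hInA : (zdGF3 𝔸 L β len i).InA α₀ U₀) (h140 : (zdGF3 𝔸 L β len i).C140 α₂ U₀ P)
    {j : ℕ} (hj : j ≤ i.k) (z : Site d) (μ : Fin d) (hbox : ∀ x, InBox (loK L j z) (bondHiK L j z μ) x → x ∈ i.Ω j) :
    avgIter L U₀.1 j z μ ∈ unitaryUnits 𝔸 ∧ tildIter L U₀.1 P.2.1 j z μ ∈ unitaryUnits 𝔸 ∧
      ‖((tildIter L U₀.1 P.2.1 j z μ : 𝔸ˣ) : 𝔸) - 1‖ ≤ 130 * (d : ℝ) * α₂ := by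
  have hL1 : 1 ≤ L := le_trans one_le_two hL
  have hd : 1 ≤ d := le_trans one_le_two hd2
  obtain ⟨hU₀cu, hBcu, hα', hα3', hα4', h52, hb, hBcn, hsmall, hc₃, hsm, hαP, hαP3, hαP2, hP, hscale, h₀, h₁⟩ :=
    clampedStanding hd2 hL i hΩ0 hα₀ hα₀c hα₂ hα₂c U₀ P hInA h140 hj (loK_le_bondHiK hL1 j z μ) hbox
  -- locality of the `j`-fold averages on the bond box
  have e₀ : avgIter L U₀.1 j z μ = avgIter L (clampCfg (loK L j z) (bondHiK L j z μ) U₀.1) j z μ := avgIter_congr L hL1 j z μ h₀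
  have e₁ : avgIter L (P.2.1 * U₀.1) j z μ =
      avgIter L (expCfg (clampFld (loK L j z) (bondHiK L j z μ) (iEta i.η (mlogCfg i.k i.η i.Ω P.2.1))) *
        clampCfg (loK L j z) (bondHiK L j z μ) U₀.1) j z μ :=
    avgIter_congr L hL1 j z μ (agreeOn_mul h₁ h₀)
  have hV₀ := avgIter_mem_unitaryUnits hL hU₀cu hα' hα3' hα4' h52 j le_rfl z μ
  have hV₁ := avgIter_mul_mem_unitaryUnits hL hU₀cu hBcu hαP hαP3 hαP2 hP j le_rfl z μ
  have htt : tildIter L U₀.1 P.2.1 j z μ =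
      tildIter L (clampCfg (loK L j z) (bondHiK L j z μ) U₀.1)
        (expCfg (clampFld (loK L j z) (bondHiK L j z μ) (iEta i.η (mlogCfg i.k i.η i.Ω P.2.1)))) j z μ := by
    rw [tildIter_apply, tildIter_apply, e₀, e₁]
  refine ⟨?_, ?_, ?_⟩
  · rw [e₀]; exact hV₀
  · rw [htt, tildIter_apply]
    exact (unitaryUnits 𝔸).mul_mem hV₁ ((unitaryUnits 𝔸).inv_mem hV₀)
  · have h := norm_tildIter_sub_one_le hd hL hU₀cu hBcu hα' hα3' hα4' h52 hb hBcn hsmall hc₃ hsm hαP hαP3 hαP2 hP le_rfl z μ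
    rw [hscale] at h
    rw [htt]
    exact h

/-- **(1.145) IN THE CARRIER's BOX FORM FOR PRINT'S TOWER-WISE MAP, with the constant `530·d`**: at a member of `zdGF3` with `Ω₀ = ℤᵈ` (`d, L ≥ 2`),
for `0 < α₀, α₂ ≤ c(d, L)` and every datum with (1.139) ∕ (1.140): at EVERY level `j ≤ k` and EVERY `j`-bond whose box lies in `Ω_j`,
`|(U′U₀)‾ʲ_b − (Ū₀ʲ)_b| ≤ 530d·α₂`, `U′U₀ = (U₁U₀)^{u}`, `u = uTower`.  PROOF ([3] (70)–(71), r05 g7's bookkeeping behind `norm_tildIter_fixed_sub_one_le`,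
now TOWER-WISE): `Ũ′ʲ_b = u(b₋)·Ũʲ_b·R̄(u(b₊))⁻¹` (`tildIter_mgauge`) with `|u − 1| ≤ 200d·α₂` at both ends (`uTower_facts` — the two ends may lie
in DIFFERENT towers) and `|Ũʲ_b − 1| ≤ 130d·α₂` (`bond_facts`); then `(U′U₀)‾ʲ_b − Ū₀ʲ_b = (Ũ′ʲ_b − 1)Ū₀ʲ_b` with `Ū₀ʲ_b` unitary.  So
`(zdGF3 …).avgClose (530d·α₂) U₀ (toAxialTower … U₀ P)`. [cite: Balaban1985RegularSpaces, Prop. 7 (1.145) p.100 (inequality, constant repaired: audit G-adv8-16 ∕ `B8Ineq145`), (1.35) p.82, (1.66) p.88; Balaban1985Averaging, (69)–(71) p.29, (163) p.42] -/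
theorem avgClose_toAxialTower (hd2 : 2 ≤ d) (hL : 2 ≤ L) (i : ZdIdx d L) (hΩ0 : i.Ω 0 = Set.univ)
    {α₀ α₂ : ℝ} (hα₀ : 0 < α₀) (hα₀c : α₀ ≤ cst d L) (hα₂ : 0 < α₂) (hα₂c : α₂ ≤ cst d L)
    (U₀ : (zdGF3 𝔸 L β len i).Cfg) (P : (zdGF3 𝔸 L β len i).Pert)
    (hInA : (zdGF3 𝔸 L β len i).InA α₀ U₀) (h140 : (zdGF3 𝔸 L β len i).C140 α₂ U₀ P) :
    (zdGF3 𝔸 L β len i).avgClose (530 * (d : ℝ) * α₂) U₀ (toAxialTower 𝔸 L β len (le_trans one_le_two hL) i U₀ P) := by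
  have hL1 : 1 ≤ L := le_trans one_le_two hL
  have hu := uTower_facts hd2 hL i hΩ0 hα₀ hα₀c hα₂ hα₂c U₀ P hInA h140
  rw [B8Prop7TowerAxialZd3.toAxialTower_of_unitary hL1 i U₀ P (fun x => (hu x).1)]
  intro j hj z μ hbox
  set u := uTower L hL1 i.k (i.Λs i.k) U₀.1 P.2.1 with hu_def
  show ‖((avgIter L (mulCfg (mgauge U₀.1 u P.2.1) U₀.1) j z μ : 𝔸ˣ) : 𝔸) - ((avgIter L U₀.1 j z μ : 𝔸ˣ) : 𝔸)‖ ≤ 530 * (d : ℝ) * α₂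
  obtain ⟨hV₀, htildU, htild⟩ := bond_facts hd2 hL i hΩ0 hα₀ hα₀c hα₂ hα₂c U₀ P hInA h140 hj z μ hbox
  -- (69): `(U′U₀)‾ʲ_b = Ũ′ʲ_b · Ū₀ʲ_b`
  have hsplit : avgIter L (mulCfg (mgauge U₀.1 u P.2.1) U₀.1) j z μ =
      tildIter L U₀.1 (mgauge U₀.1 u P.2.1) j z μ * avgIter L U₀.1 j z μ := by
    rw [mulCfg_eq_mul, ← tildIter_mul]; rfl
  -- (70)–(71): `Ũ′ʲ_b = u(b₋)·Ũʲ_b·R̄(u(b₊))⁻¹`, three factors near `1`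
  have hX : ‖((tildIter L U₀.1 (mgauge U₀.1 u P.2.1) j z μ : 𝔸ˣ) : 𝔸) - 1‖ ≤ 530 * (d : ℝ) * α₂ := by
    rw [tildIter_mgauge, mgauge_apply]
    obtain ⟨ha1, han⟩ := hu (((L : ℤ) ^ j) • z)
    obtain ⟨hc1, hcn⟩ := hu (((L : ℤ) ^ j) • (z + e μ))
    have ha : uLev L u j z ∈ U1 𝔸 := unitaryUnits_le_U1 ha1
    have hb' : tildIter L U₀.1 P.2.1 j z μ ∈ U1 𝔸 := unitaryUnits_le_U1 htildU
    have hR : Rc (avgIter L U₀.1 j z μ) (uLev L u j (z + e μ)) ∈ U1 𝔸 := unitaryUnits_le_U1 (Rc_mem_unitaryUnits hV₀ hc1)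
    have h3 : ‖((uLev L u j z * tildIter L U₀.1 P.2.1 j z μ * (Rc (avgIter L U₀.1 j z μ) (uLev L u j (z + e μ)))⁻¹ : 𝔸ˣ) : 𝔸) - 1‖
        ≤ ‖((uLev L u j z : 𝔸ˣ) : 𝔸) - 1‖ + ‖((tildIter L U₀.1 P.2.1 j z μ : 𝔸ˣ) : 𝔸) - 1‖ +
          ‖(((Rc (avgIter L U₀.1 j z μ) (uLev L u j (z + e μ)))⁻¹ : 𝔸ˣ) : 𝔸) - 1‖ :=
      norm_mul₃_units_sub_one_le ha hb'
    have hcb : ‖(((Rc (avgIter L U₀.1 j z μ) (uLev L u j (z + e μ)))⁻¹ : 𝔸ˣ) : 𝔸) - 1‖ ≤ 200 * (d : ℝ) * α₂ := by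
      refine (norm_inv_sub_one_le hR).trans ?_
      rw [Rc_apply, Units.val_mul, Units.val_mul]
      exact (norm_units_conj_sub_one_le (unitaryUnits_le_U1 hV₀) _).trans hcn
    have han' : ‖((uLev L u j z : 𝔸ˣ) : 𝔸) - 1‖ ≤ 200 * (d : ℝ) * α₂ := han
    linarith [h3, han', htild, hcb]
  rw [hsplit, Units.val_mul]
  have hY : ‖((avgIter L U₀.1 j z μ : 𝔸ˣ) : 𝔸)‖ ≤ 1 := (unitaryUnits_le_U1 hV₀).1
  have key : ((tildIter L U₀.1 (mgauge U₀.1 u P.2.1) j z μ : 𝔸ˣ) : 𝔸) * ((avgIter L U₀.1 j z μ : 𝔸ˣ) : 𝔸)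
        - ((avgIter L U₀.1 j z μ : 𝔸ˣ) : 𝔸)
      = (((tildIter L U₀.1 (mgauge U₀.1 u P.2.1) j z μ : 𝔸ˣ) : 𝔸) - 1) * ((avgIter L U₀.1 j z μ : 𝔸ˣ) : 𝔸) := by
    noncomm_ring
  rw [key]
  calc _ ≤ ‖((tildIter L U₀.1 (mgauge U₀.1 u P.2.1) j z μ : 𝔸ˣ) : 𝔸) - 1‖ * ‖((avgIter L U₀.1 j z μ : 𝔸ˣ) : 𝔸)‖ := norm_mul_le _ _
    _ ≤ 530 * (d : ℝ) * α₂ * 1 := mul_le_mul hX hY (norm_nonneg _) (by positivity)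
    _ = _ := mul_one _

end Ineq145

/-! ## §6 PROPOSITION 7 REPAIRED (`B8Ineq145.Prop7RepairedC (530·d)`) FOR PRINT'S MAP over every law-abiding sub-family with `Ω₀ = ℤᵈ` -/

section Prop7

variable (𝔸 : Type) [CStarAlgebra 𝔸] [Nontrivial 𝔸] (L : ℕ) (β : ℝ) (len : Site d → ℝ)

/-- **PROPOSITION 7 WITH THE AUDIT's REPAIRED CONSTANT, FOR PRINT'S TOWER-WISE AXIAL MAP, AT EVERY LAW MEMBER** — `B8Ineq145.Prop7RepairedC (530·d)
(zdGF3 ∘ e) (toAxialTower ∘ e)` for ANY index map `e : J → ZdIdx d L` into members with `Ω₀ = ℤᵈ` obeying NODE 00's located law №8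
(`trunc_lt` ∕ `trunc_top`): «∃ c(d, L) > 0, ∀ members, ∀ 0 < α₀, α₂ ≤ c, ∀ U₀, U₁ with (1.139), (1.140): U′U₀ = (U₁U₀)^{u} ∈ 𝔄_k({Ω_j}, α₀ + 3α₂)
∩ Ax(𝔅, U₀) (1.144) and |(U′U₀)‾ʲ − Ū₀ʲ| ≤ 530d·α₂ in the carrier's (1.66)₁ box form of (1.35) (1.145)», `u = uTower` = [3]'s gauge fixing of
the DEEPEST listed tower at each site = print's (1.29)-restricted tower-wise `u` on the members whose towers partition (`uTower_of_maximal`),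
the GLOBAL `glev … k 0` on the all-`ℤᵈ` family (`uTower_lamTop`: there this theorem is g4's `prop7RepairedC_zdGF3_univ` ∕ r05 g7's
`prop7RepairedC_admitted`).  The threshold is r05 g7's `cst d L`.  This is the HONEST counterpart, at GENERAL members, of the junk certificate
`B8Prop7GlevZd3.prop7PrintedR_zdGF3_unitAxial`; the constant `530d` (not print's `2`) is the audit's located repair (`B8Ineq145`, G-adv8-16) read in
the box form.  [cite: Balaban1985RegularSpaces, Prop. 7 (1.144)–(1.145) p.100, (1.139)–(1.141) p.100, (1.19) p.79, (1.29) p.81, (1.35) p.82, (1.66) p.88, (1.5)–(1.6) p.77; Balaban1985Averaging, (67)–(71) p.29, (76)–(77) pp.29–30, (87) p.31, (163) p.42] -/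
theorem prop7RepairedC_zdGF3_toAxialTower (hd2 : 2 ≤ d) (hL : 2 ≤ L) {J : Type} (e : J → ZdIdx d L) (hΩ0 : ∀ a, (e a).Ω 0 = Set.univ)
    (hlt : ∀ a, ∀ m, m < (e a).k → ∀ j, j < m → (e a).Λs m j = (e a).Λs (m + 1) j)
    (htop : ∀ a, ∀ m, m < (e a).k → ∀ x, x ∈ (e a).Λs m m ↔ x ∈ (e a).Λs (m + 1) m ∨ ∃ y ∈ (e a).Λs (m + 1) (m + 1),
      x ∈ Literature.MathematicalPhysics.QuantumLattice.blockSites L y) :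
    B8Ineq145.Prop7RepairedC (530 * (d : ℝ)) (fun a : J => zdGF3 𝔸 L β len (e a))
      (fun a => toAxialTower 𝔸 L β len (le_trans one_le_two hL) (e a)) := by
  have hd : 1 ≤ d := le_trans one_le_two hd2
  have hL1 : 1 ≤ L := le_trans one_le_two hL
  refine ⟨cst d L, cst_pos hd L hL1, ?_⟩
  intro a α₀ α₂ hα₀ hα₀c hα₂ hα₂c U₀ P hInA h140
  exact ⟨inAAx_toAxialTower_of_laws hd2 hL (e a) (hΩ0 a) (hlt a) (htop a) hα₀ hα₀c hα₂ hα₂c U₀ P hInA h140,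
    avgClose_toAxialTower hd2 hL (e a) (hΩ0 a) hα₀ hα₀c hα₂ hα₂c U₀ P hInA h140⟩

end Prop7


#print axioms avgClose_toAxialTower
#print axioms prop7RepairedC_zdGF3_toAxialTower

end Literature.MathematicalPhysics.QuantumFieldTheory.Balaban1983to89.B8Prop7TowerAxialIneq145

end
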